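import Summits.Ventures.CertifiedManyBodySolver.Rows.HalfFilledTLWords
import Literature.MathematicalPhysics.QuantumLattice.HubbardKineticEnergyDensity

/-!
# M2 rows, part 4: finite even tori ⟷ the thermodynamic limit, and the kinetic row

HONEST FRAMING (speedrun cell `mbsolver`, M2): first certified bounds; not a superconductivity
verdict; every number certified or labelled float.  This file contains NO numbers: it supplies the
typed homes (named `Prop`s) of remaining cells of the M2 table (`HOME/m2/M2-TABLE.md` v0.5: the
finite-torus energy cells `T{L}_E` and the thermodynamic-limit kinetic cell `TL_k`; the finite-torus
spin / docc cells `T{L}_C1`, `T{L}_D` are in part 5, `Rows/HalfFilledTLTorusSpin.lean`) and the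
solver-free edges between them and the thermodynamic-limit rows of `Statement.lean` §M2 /
`Rows/HalfFilledTL.lean`; a cell is filled only by a certificate-backed term of the named type.

Companion of `Rows/HalfFilledTL.lean` (TLGS(U), docc / spin rows, the two torus-family edges
`energyDensity2D_le_of_torusFamily`, `energyDensity2D_ge_of_evenTorusFamily`),
`Rows/HalfFilledTLDerived.lean` and `Rows/HalfFilledTLWords.lean` (literal certificate words).

## §1 Finite even tori: the ground-energy rows `T{L}_E` and the stated torus sequence

`M2.TorusEnergyRow L U lo hi : lo ≤ E₀(L×L torus, t = 1, U, N = L²) ≤ hi` (total energy, all `S^z`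
sectors: `groundEnergyAt (fermionTorusGraph 2 L) 1 U (L ^ 2)`), split into `TorusEnergyLowerRow` /
`TorusEnergyUpperRow`.  Readings: it is the substrate's `CertifiedBound L L 1 U (L²) lo hi`
(`TorusEnergyRow.iff_certifiedBound`, via `groundEnergyAt_fermionTorusGraph_two`), and a one-sided
substrate energy node typed on the rectangular torus with rational-cast couplings
(`… groundEnergyAt (fermionRectTorusGraph L L) ((1:ℚ):ℝ) ((U':ℚ):ℝ) N …`, `N = L²`) fills the
one-sided cell (`TorusEnergyLowerRow.of_rect_ratCast`, `TorusEnergyUpperRow.of_rect_ratCast`); for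
even `L` and `U > 0` it is the statement "every normalised `L²`-particle ground state `ψ` has
`lo ≤ Re⟨ψ, Hψ⟩ ≤ hi`" (`TorusEnergyRow.re_expect_mem`, `TorusEnergyRow.of_forall_groundState`; Lieb's
theorem supplies the ground state); a trial state gives the ceiling (`TorusEnergyUpperRow.of_trial`).
THE TORUS SEQUENCE IS STATED, NOT EXTRAPOLATED: the only passages to `L = ∞` are the two proved
edges — a certified per-site floor valid on ALL large even tori is a floor on `e₀(U)`
(`M2EnergyLowerRow.of_torusEnergyLowerRows`), and certified ceilings along the cofinal family
`L = a·k` (even `a`) are a ceiling on `e₀(U)` (`M2EnergyUpperRow.of_torusEnergyUpperRows`: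
`e₀ = inf_L E₀(L×L)/L²`).  A single torus number is never a thermodynamic-limit number here.

## §2 The thermodynamic-limit kinetic row `TL_k`

`M2.KineticRow U lo hi : lo ≤ k(U) ≤ hi` on TLGS(U), where `k(U) = Re ω(k₀)`,
`k₀ = −Σ_{i=1,2} Σ_σ (c†_{0σ}c_{e_iσ} + c†_{e_iσ}c_{0σ}) ∈ 𝔄_{{0,e₁,e₂}}` is the kinetic energy per
site at `t = 1`, written (`M2.kineticWords (-1)`) as the eight normal-ordered words of the substrate's
`…_Klo` kinetic certificates in the generators `cNN` (`M2.kineticWords 1 = −k₀` are the `…_Kup` words).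
On TLGS(U), `k(U) = e₀(U) − U·d(U)` EXACTLY (`IsTLGS.re_expect_kineticWords`: translation invariance
of torus limits + `e₀ = lim E₀(L×L)/L²`), so the cell has a solver-free filling from the energy and
docc rows (`KineticRow.of_energy_docc`) besides the certificate one (`KineticRow.of_lower_upper`),
and conversely kinetic rows bound the double occupancy (`DoccRow.of_energy_kinetic`, `U > 0`).

References: Lieb, PRL 62 (1989) 1201, Theorem 2; Lieb–Loss–McCann, J. Math. Phys. 34 (1993) 891,
p. 894; Bratteli–Robinson II (1997) §6.2.4; Ruelle (1969) §3.3–3.4 and Simon (1993) §II.2–II.3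
(thermodynamic limit by sub/superadditivity); Tasaki (2020) §2.1, §10.1; Friedli–Velenik (2017) §3.1;
Wang et al., PRX 14 (2024) 031006 §III (certified SDP lower bounds with an energy constraint);
Essler–Frahm–Göhmann–Klümper–Korepin (2005) §2.2.5.
-/

noncomputable section

namespace Summit.Ventures.CertifiedManyBodySolver

open Literature.MathematicalPhysics.QuantumLattice
open Matrix HubbardWave0 Literature.Probability.LatticeModels FermionSpinMoment ThermodynamicLimit
  Filter Topology
open Literature.MathematicalPhysics.QuantumLattice.FermionTorus (ofTorusSite toTorusSite)
open Summit.HubbardSuperconductivity.ManyBodyBootstrap.Bounds (E₀ CertifiedBound nnSupport cNN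
  zero_mem_nnSupport e1_mem_nnSupport e2_mem_nnSupport)
open scoped ComplexOrder BigOperators

namespace M2

/-! ## §1 Finite-torus ground-energy rows and the stated torus sequence -/

/-- **Finite-torus energy floor** `T{L}_E.lo`: `lo ≤ E₀(L × L torus, t = 1, U, N = L²)` (total
ground-state energy over all `L²`-particle states, every `S^z` sector).
[cite: LiebPRL1989, Theorem 2] [cite: FriedliVelenik2017, §3.1] -/
def TorusEnergyLowerRow (L : ℕ) (U : ℝ) (lo : ℚ) : Prop :=
  ((lo : ℚ) : ℝ) ≤ groundEnergyAt (fermionTorusGraph 2 L) 1 U (L ^ 2)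

/-- **Finite-torus energy ceiling** `T{L}_E.hi`: `E₀(L × L torus, t = 1, U, N = L²) ≤ hi`.
[cite: LiebPRL1989, Theorem 2] [cite: FriedliVelenik2017, §3.1] -/
def TorusEnergyUpperRow (L : ℕ) (U : ℝ) (hi : ℚ) : Prop :=
  groundEnergyAt (fermionTorusGraph 2 L) 1 U (L ^ 2) ≤ ((hi : ℚ) : ℝ)

/-- **Finite-torus energy row** `T{L}_E`: `lo ≤ E₀(L × L, 1, U, L²) ≤ hi`.
[cite: LiebPRL1989, Theorem 2] [cite: FriedliVelenik2017, §3.1] -/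
def TorusEnergyRow (L : ℕ) (U : ℝ) (lo hi : ℚ) : Prop :=
  TorusEnergyLowerRow L U lo ∧ TorusEnergyUpperRow L U hi

/-- `TorusEnergyRow` unfolded. [cite: FriedliVelenik2017, §3.1] -/
theorem torusEnergyRow_iff {L : ℕ} {U : ℝ} {lo hi : ℚ} :
    TorusEnergyRow L U lo hi ↔
      ((lo : ℚ) : ℝ) ≤ groundEnergyAt (fermionTorusGraph 2 L) 1 U (L ^ 2) ∧
        groundEnergyAt (fermionTorusGraph 2 L) 1 U (L ^ 2) ≤ ((hi : ℚ) : ℝ) := Iff.rfl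

/-- The floor with the particle number as a numeral `N = L²` (certificates write `16`, `36`, …).
[cite: FriedliVelenik2017, §3.1] -/
theorem torusEnergyLowerRow_iff_of_sq {L N : ℕ} (hN : L ^ 2 = N) {U : ℝ} {lo : ℚ} :
    TorusEnergyLowerRow L U lo ↔ ((lo : ℚ) : ℝ) ≤ groundEnergyAt (fermionTorusGraph 2 L) 1 U N := by
  rw [TorusEnergyLowerRow, hN]

/-- The ceiling with the particle number as a numeral. [cite: FriedliVelenik2017, §3.1] -/
theorem torusEnergyUpperRow_iff_of_sq {L N : ℕ} (hN : L ^ 2 = N) {U : ℝ} {hi : ℚ} :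
    TorusEnergyUpperRow L U hi ↔ groundEnergyAt (fermionTorusGraph 2 L) 1 U N ≤ ((hi : ℚ) : ℝ) := by
  rw [TorusEnergyUpperRow, hN]

/-- The `L × L` torus of `fermionTorusGraph 2 L` IS the rectangular torus `fermionRectTorusGraph L L`
of the substrate's energy certificates: the floor, rectangular reading.
[cite: FriedliVelenik2017, §3.1] -/
theorem torusEnergyLowerRow_iff_rect {L : ℕ} {U : ℝ} {lo : ℚ} :
    TorusEnergyLowerRow L U lo ↔
      ((lo : ℚ) : ℝ) ≤ groundEnergyAt (fermionRectTorusGraph L L) 1 U (L ^ 2) := by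
  rw [TorusEnergyLowerRow, groundEnergyAt_fermionTorusGraph_two]

/-- The ceiling, rectangular reading. [cite: FriedliVelenik2017, §3.1] -/
theorem torusEnergyUpperRow_iff_rect {L : ℕ} {U : ℝ} {hi : ℚ} :
    TorusEnergyUpperRow L U hi ↔
      groundEnergyAt (fermionRectTorusGraph L L) 1 U (L ^ 2) ≤ ((hi : ℚ) : ℝ) := by
  rw [TorusEnergyUpperRow, groundEnergyAt_fermionTorusGraph_two]

/-- **`T{L}_E` is the substrate's `CertifiedBound L L 1 U (L²) lo hi`** (`Bounds/Defs.lean`: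
`lo ≤ E₀ L L 1 U (L²) ≤ hi`, `E₀ a b t U N = groundEnergyAt (fermionRectTorusGraph a b) t U N`), for
rational `U`. [cite: FriedliVelenik2017, §3.1] -/
theorem TorusEnergyRow.iff_certifiedBound {L : ℕ} {U lo hi : ℚ} :
    TorusEnergyRow L U lo hi ↔ CertifiedBound L L 1 U (L ^ 2) lo hi := by
  rw [TorusEnergyRow, torusEnergyLowerRow_iff_rect, torusEnergyUpperRow_iff_rect, CertifiedBound, E₀,
    Rat.cast_one]

/-- A substrate energy certificate `CertifiedBound L L 1 U N lo hi` with `N = L²` a numeral fills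
`T{L}_E`. [cite: FriedliVelenik2017, §3.1] -/
theorem TorusEnergyRow.of_certifiedBound {L N : ℕ} (hN : L ^ 2 = N) {U lo hi : ℚ}
    (h : CertifiedBound L L 1 U N lo hi) : TorusEnergyRow L U lo hi := by
  rw [TorusEnergyRow.iff_certifiedBound, hN]
  exact h

/-- **One-sided substrate energy nodes fill the one-sided cells**: a floor typed, as the E2 / FK rows
are, on the rectangular torus with rational-cast couplings,
`lo ≤ groundEnergyAt (fermionRectTorusGraph L L) ((1:ℚ):ℝ) ((U':ℚ):ℝ) N` (`E0Lower L L 1 U' N lo`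
unfolded), with `N = L²` and `(U' : ℝ) = U`, is `TorusEnergyLowerRow L U lo`. [cite: FriedliVelenik2017, §3.1] -/
theorem TorusEnergyLowerRow.of_rect_ratCast {L N : ℕ} (hN : L ^ 2 = N) {U : ℝ} {U' lo : ℚ}
    (hU : ((U' : ℚ) : ℝ) = U)
    (h : ((lo : ℚ) : ℝ) ≤ groundEnergyAt (fermionRectTorusGraph L L) ((1 : ℚ) : ℝ) ((U' : ℚ) : ℝ) N) :
    TorusEnergyLowerRow L U lo := by
  rw [torusEnergyLowerRow_iff_rect, hN, ← hU]
  simpa only [Rat.cast_one] using h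

/-- The ceiling twin: `groundEnergyAt (fermionRectTorusGraph L L) ((1:ℚ):ℝ) ((U':ℚ):ℝ) N ≤ hi`
(`E0Upper L L 1 U' N hi` unfolded, e.g. an exact Rayleigh quotient of a Lanczos vector) with `N = L²`,
`(U' : ℝ) = U` is `TorusEnergyUpperRow L U hi`. [cite: FriedliVelenik2017, §3.1] [cite: Tasaki2020, §2.1] -/
theorem TorusEnergyUpperRow.of_rect_ratCast {L N : ℕ} (hN : L ^ 2 = N) {U : ℝ} {U' hi : ℚ}
    (hU : ((U' : ℚ) : ℝ) = U)
    (h : groundEnergyAt (fermionRectTorusGraph L L) ((1 : ℚ) : ℝ) ((U' : ℚ) : ℝ) N ≤ ((hi : ℚ) : ℝ)) :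
    TorusEnergyUpperRow L U hi := by
  rw [torusEnergyUpperRow_iff_rect, hN, ← hU]
  simpa only [Rat.cast_one] using h

/-- **A ground state's energy expectation is the ground energy**: `Re⟨ψ, Hψ⟩ = E₀(G, t, U, N)` for a
normalised `N`-particle ground state `ψ` of `hamiltonian G t U` (`Hψ = E₀ψ`, `‖ψ‖ = 1`).
[cite: Tasaki2020, §2.1] -/
theorem re_expect_hamiltonian_eq_groundEnergyAt {Λ : Type*} [LinearOrder Λ] [Fintype Λ]
    (G : SimpleGraph Λ) [DecidableRel G.Adj] {t U : ℝ} {N : ℕ} {ψ : Fock (Orb Λ)}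
    (hψ : IsGroundState (hamiltonian G t U) N ψ) (h1 : star ψ ⬝ᵥ ψ = 1) :
    (expect (hamiltonian G t U) ψ).re = groundEnergyAt G t U N := by
  rw [expect, hψ.2.2, dotProduct_smul, h1, smul_eq_mul, mul_one, Complex.ofReal_re, groundEnergyAt]

/-- **`T{L}_E` read on ground states**: `lo ≤ Re⟨ψ, Hψ⟩ ≤ hi` for every normalised `L²`-particle
ground state `ψ` of the `L × L` torus (the M2 table's two-sided `lean` string of the cell).
[cite: Tasaki2020, §2.1] [cite: LiebPRL1989, Theorem 2] -/
theorem TorusEnergyRow.re_expect_mem {L : ℕ} {U : ℝ} {lo hi : ℚ} (h : TorusEnergyRow L U lo hi)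
    {ψ : Fock (Orb (FermionTorus 2 L))}
    (hψ : IsGroundState (hamiltonian (fermionTorusGraph 2 L) 1 U) (L ^ 2) ψ) (h1 : star ψ ⬝ᵥ ψ = 1) :
    ((lo : ℚ) : ℝ) ≤ (expect (hamiltonian (fermionTorusGraph 2 L) 1 U) ψ).re ∧
      (expect (hamiltonian (fermionTorusGraph 2 L) 1 U) ψ).re ≤ ((hi : ℚ) : ℝ) := by
  rw [re_expect_hamiltonian_eq_groundEnergyAt _ hψ h1]
  exact h

/-- **Conversely**, on an EVEN torus with `U > 0` (where Lieb's theorem provides a normalised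
`L²`-particle ground state), bounds on `Re⟨ψ, Hψ⟩` for all such ground states ARE the row.
[cite: LiebPRL1989, Theorem 2] [cite: Tasaki2020, §10.1] -/
theorem TorusEnergyRow.of_forall_groundState {L : ℕ} [NeZero L] (hL : Even L) {U : ℝ} (hU : 0 < U)
    {lo hi : ℚ}
    (h : ∀ ψ : Fock (Orb (FermionTorus 2 L)),
      IsGroundState (hamiltonian (fermionTorusGraph 2 L) 1 U) (L ^ 2) ψ → star ψ ⬝ᵥ ψ = 1 →
        ((lo : ℚ) : ℝ) ≤ (expect (hamiltonian (fermionTorusGraph 2 L) 1 U) ψ).re ∧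
          (expect (hamiltonian (fermionTorusGraph 2 L) 1 U) ψ).re ≤ ((hi : ℚ) : ℝ)) :
    TorusEnergyRow L U lo hi := by
  obtain ⟨ψ, hψK, hψ1, hHψ, -⟩ :=
    LiebHalfFilled.hubbardTorus_exists_unit_groundState_pow (d := 2) (L := L) two_pos hL one_ne_zero hU
  have hN : IsNParticle (L ^ 2) ψ := ((mem_szSector_iff _ _ _).1 hψK).1
  have hne : ψ ≠ 0 := by
    rintro rfl
    rw [star_zero, zero_dotProduct] at hψ1
    exact zero_ne_one hψ1
  have hgs : IsGroundState (hamiltonian (fermionTorusGraph 2 L) 1 U) (L ^ 2) ψ := ⟨hN, hne, hHψ⟩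
  have hb := h ψ hgs hψ1
  rwa [re_expect_hamiltonian_eq_groundEnergyAt _ hgs hψ1] at hb

/-- **A trial state certifies the ceiling** (variational principle): any normalised `L²`-particle
`φ` with `Re⟨φ, Hφ⟩ ≤ hi` gives `T{L}_E.hi`. [cite: Tasaki2020, §2.1] -/
theorem TorusEnergyUpperRow.of_trial {L : ℕ} {U : ℝ} {hi : ℚ} {φ : Fock (Orb (FermionTorus 2 L))}
    (hφ : IsNParticle (L ^ 2) φ) (h1 : star φ ⬝ᵥ φ = 1)
    (h : (expect (hamiltonian (fermionTorusGraph 2 L) 1 U) φ).re ≤ ((hi : ℚ) : ℝ)) :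
    TorusEnergyUpperRow L U hi :=
  (LiebThm1.groundEnergy_le_re_expect _ hφ h1).trans h

/-- **Torus sequence ⟹ thermodynamic-limit floor (proved edge, no extrapolation)**: a per-site floor
`lo · L² ≤ E₀(L × L)` certified for ALL even `L ≥ L₀` is a floor `lo ≤ e₀(U)` (`U ≥ 0`;
`e₀ = lim_{L even} E₀(L×L)/L²`, `energyDensity2D_ge_of_evenTorusFamily`).  This is the shape of a
translation-invariant (size-independent) lower-bound certificate.
[cite: Ruelle1969, §3.3–3.4] [cite: Simon1993, §II.2–II.3] [cite: WangEtAl2024, §III] -/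
theorem _root_.Summit.Ventures.CertifiedManyBodySolver.M2EnergyLowerRow.of_torusEnergyLowerRows {U : ℝ} (hU : 0 ≤ U) {L₀ : ℕ} {lo : ℚ}
    (h : ∀ L : ℕ, L₀ ≤ L → Even L → TorusEnergyLowerRow L U (lo * (L : ℚ) ^ 2)) :
    M2EnergyLowerRow U lo := by
  refine energyDensity2D_ge_of_evenTorusFamily hU (L₀ := L₀) fun L hL hev => ?_
  have hb := h L hL hev
  unfold TorusEnergyLowerRow at hb
  push_cast at hb
  linarith

/-- **Torus sequence ⟹ thermodynamic-limit ceiling (proved edge, no extrapolation)**: per-site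
ceilings `E₀((a k) × (a k)) ≤ u · (a k)²` certified along the cofinal family `L = a·k`, `k ≥ 1` (`a`
even, e.g. ED / a certified upper bound on each torus, or ONE torus `a × a` whose bound is inherited
by its multiples), give `e₀(U) ≤ u` (`U ≥ 0`; `e₀ = inf_L E₀(L×L)/L²`,
`energyDensity2D_le_of_torusFamily`). [cite: Ruelle1969, §3.3–3.4] [cite: Simon1993, §II.2–II.3] -/
theorem _root_.Summit.Ventures.CertifiedManyBodySolver.M2EnergyUpperRow.of_torusEnergyUpperRows {U : ℝ} (hU : 0 ≤ U) {a : ℕ} (ha : 1 ≤ a)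
    (hae : Even a) {u : ℚ}
    (h : ∀ k : ℕ, 1 ≤ k → TorusEnergyUpperRow (a * k) U (u * ((a : ℚ) * k) ^ 2)) :
    M2EnergyUpperRow U u := by
  refine energyDensity2D_le_of_torusFamily hU ha hae fun k hk => ?_
  have hb := h k hk
  rw [torusEnergyUpperRow_iff_rect] at hb
  push_cast at hb ⊢
  linarith

/-! ## §2 The thermodynamic-limit kinetic row -/

/-- `e_i ∈ {0, e₁, e₂}` as ONE function of `i` (the kinetic lemmas of
`HubbardKineticEnergyDensity` take the membership certificates in this form). [folklore] -/
theorem unitVec_mem_nnSupport (i : Fin 2) : (unitVec i : Site 2) ∈ nnSupport := by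
  fin_cases i
  · exact e1_mem_nnSupport
  · exact e2_mem_nnSupport

/-- **The window hopping operator** `T₀ = Σ_{i=1,2} Σ_σ (c†_{0σ}c_{e_iσ} + c†_{e_iσ}c_{0σ}) ∈ 𝔄_{{0,e₁,e₂}}`
(`t = 1`; the kinetic energy per site is `k₀ = −T₀`). [cite: EsslerEtAl2005, §2.2.5 eq. (2.66) and (2.71)–(2.73)] -/
def hoppingNN : FermionOp nnSupport :=
  ∑ i : Fin 2, ∑ σ : Fin 2,
    ((cAt 0 zero_mem_nnSupport σ)ᴴ * cAt (unitVec i) (unitVec_mem_nnSupport i) σ +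
      (cAt (unitVec i) (unitVec_mem_nnSupport i) σ)ᴴ * cAt 0 zero_mem_nnSupport σ)

/-- **The literal kinetic words** of the substrate's `…_Klo` (`q = −1`: the operator `k₀` itself) and
`…_Kup` (`q = 1`: `−k₀`) certificates, verbatim in the generators `cNN i σ` (`i = 0 ↦ 0`, `1 ↦ e₁`,
`2 ↦ e₂`) and in the bundle's word order. [cite: WangEtAl2024, §III] -/
def kineticWords (q : ℚ) : FermionOp nnSupport :=
  ((q : ℚ) : ℂ) • ((cNN 0 0)ᴴ * cNN 2 0) +
  ((q : ℚ) : ℂ) • ((cNN 0 0)ᴴ * cNN 1 0) +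
  ((q : ℚ) : ℂ) • ((cNN 0 1)ᴴ * cNN 2 1) +
  ((q : ℚ) : ℂ) • ((cNN 0 1)ᴴ * cNN 1 1) +
  ((q : ℚ) : ℂ) • ((cNN 2 0)ᴴ * cNN 0 0) +
  ((q : ℚ) : ℂ) • ((cNN 2 1)ᴴ * cNN 0 1) +
  ((q : ℚ) : ℂ) • ((cNN 1 0)ᴴ * cNN 0 0) +
  ((q : ℚ) : ℂ) • ((cNN 1 1)ᴴ * cNN 0 1)

/-- **The literal words are `q • T₀`.** [cite: EsslerEtAl2005, §2.2.5 eq. (2.66) and (2.71)–(2.73)] -/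
theorem kineticWords_eq (q : ℚ) : kineticWords q = ((q : ℚ) : ℂ) • hoppingNN := by
  unfold kineticWords hoppingNN
  simp only [cNN, Fin.sum_univ_two, smul_add]
  abel

/-- **The thermodynamic-limit kinetic row** `TL_k`: `lo ≤ k(U) ≤ hi` on TLGS(U), `k(U) = Re ω(k₀)`
with `k₀ = kineticWords (-1)` the kinetic energy per site. [cite: WangEtAl2024, §III]
[cite: BratteliRobinsonII1997, §6.2.4] -/
def KineticRow (U : ℝ) (lo hi : ℚ) : Prop := CorrelatorRow U nnSupport (kineticWords (-1)) lo hi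

/-- **Certificate-shaped kinetic floor** (`…_Klo` node shape): `q ≤ Re ω(k₀)` on torus-limit ground
states given the energy ceiling `e₀(U) ≤ u`. [cite: WangEtAl2024, §III] -/
def KineticLowerRow (U : ℝ) (u q : ℚ) : Prop := SquareCorrLowerRow U u q nnSupport (kineticWords (-1))

/-- **Certificate-shaped kinetic ceiling** (`…_Kup` node shape): `q ≤ Re ω(−k₀)`, i.e. `k(U) ≤ −q`,
given `e₀(U) ≤ u`. [cite: WangEtAl2024, §III] -/
def KineticUpperRow (U : ℝ) (u q : ℚ) : Prop := SquareCorrLowerRow U u q nnSupport (kineticWords 1)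

/-- **`Re ω(T₀) = U·d − e₀` on TLGS(U)** (`U ≥ 0`): translation invariance of torus limits
(`h_ω = U·D_ω − t·Re ω(T₀)`) and `h_ω = e₀(U)` for torus-limit ground states.
[cite: BratteliRobinsonII1997, §6.2.4] [cite: Simon1993, §II.2–II.3] -/
theorem IsTLGS.re_expect_hoppingNN {U : ℝ} (hU : 0 ≤ U) {ω : InfVolFermionState 2} (h : IsTLGS U ω) :
    (ω.expect nnSupport hoppingNN).re =
      U * (ω.expect {0} (doccAt0 2)).re - energyDensity2D 1 U 1 := by
  obtain ⟨Ls, ψ, hLs, hev, hψ, h1, hω⟩ := h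
  have hk := hω.neg_t_mul_re_expect_hoppingWindow_eq hLs hev 1 hU hψ h1
  unfold hoppingNN doccAt0
  linarith

/-- **The kinetic words on TLGS(U)**: `Re ω(kineticWords q) = −q · (e₀(U) − U·d_ω)`; in particular
`Re ω(k₀) = e₀(U) − U·d_ω` (`q = −1`). [cite: BratteliRobinsonII1997, §6.2.4] [cite: WangEtAl2024, §III] -/
theorem IsTLGS.re_expect_kineticWords {U : ℝ} (hU : 0 ≤ U) {ω : InfVolFermionState 2}
    (h : IsTLGS U ω) (q : ℚ) :
    (ω.expect nnSupport (kineticWords q)).re =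
      -q * (energyDensity2D 1 U 1 - U * (ω.expect {0} (doccAt0 2)).re) := by
  rw [kineticWords_eq, map_smul, smul_eq_mul, ← Complex.ofReal_ratCast, Complex.re_ofReal_mul,
    h.re_expect_hoppingNN hU]
  ring

/-- **`k(U) = e₀(U) − U·d` on TLGS(U)**, the `q = −1` case. [cite: BratteliRobinsonII1997, §6.2.4] -/
theorem IsTLGS.kinetic_eq {U : ℝ} (hU : 0 ≤ U) {ω : InfVolFermionState 2} (h : IsTLGS U ω) :
    (ω.expect nnSupport (kineticWords (-1))).re =
      energyDensity2D 1 U 1 - U * (ω.expect {0} (doccAt0 2)).re := by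
  rw [h.re_expect_kineticWords hU]
  push_cast
  ring

/-- **Solver-free `TL_k`**: the energy row `elo ≤ e₀(U) ≤ ehi` and the docc row `dlo ≤ d ≤ dhi`
(`U ≥ 0`) give `KineticRow U klo khi` for any rationals with `klo ≤ elo − U·dhi` and
`ehi − U·dlo ≤ khi` (`k = e₀ − U d` exactly on TLGS(U)). [cite: BratteliRobinsonII1997, §6.2.4]
[cite: LiebWu1968, eq. (15) and Fig. 3 (d⟨H⟩/dU = Σ⟨n↑n↓⟩, Hellmann–Feynman)] -/
theorem KineticRow.of_energy_docc {U : ℝ} (hU : 0 ≤ U) {elo ehi dlo dhi klo khi : ℚ}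
    (hel : M2EnergyLowerRow U elo) (heu : M2EnergyUpperRow U ehi) (hd : DoccRow U dlo dhi)
    (hklo : ((klo : ℚ) : ℝ) ≤ (elo : ℝ) - U * dhi) (hkhi : ((ehi : ℚ) : ℝ) - U * dlo ≤ ((khi : ℚ) : ℝ)) :
    KineticRow U klo khi := by
  intro ω hω
  obtain ⟨hdl, hdu⟩ := hd ω hω
  have hel' : ((elo : ℚ) : ℝ) ≤ energyDensity2D 1 U 1 := hel
  have heu' : energyDensity2D 1 U 1 ≤ ((ehi : ℚ) : ℝ) := heu
  rw [hω.kinetic_eq hU]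
  constructor
  · nlinarith [mul_le_mul_of_nonneg_left hdu hU]
  · nlinarith [mul_le_mul_of_nonneg_left hdl hU]

/-- **Certificate filling of `TL_k`**: the energy ceiling `e₀(U) ≤ u` the two kinetic nodes were issued
for, a `…_Klo`-shaped node (`k ≥ lo`) and a `…_Kup`-shaped node (`−k ≥ hi'`) give
`KineticRow U lo (−hi')`. [cite: WangEtAl2024, §III] -/
theorem KineticRow.of_lower_upper {U : ℝ} {u lo hi' : ℚ} (hE : M2EnergyUpperRow U u)
    (hlo : KineticLowerRow U u lo) (hup : KineticUpperRow U u hi') : KineticRow U lo (-hi') := by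
  refine CorrelatorRow.of_lower_upper hE hlo ?_
  intro ω Ls ψ hLs hev hψ h1 hω hu
  have hq := hup ω Ls ψ hLs hev hψ h1 hω hu
  have hneg : kineticWords 1 = -kineticWords (-1) := by
    rw [kineticWords_eq, kineticWords_eq]
    push_cast
    module
  rw [hneg, map_neg, Complex.neg_re] at hq
  push_cast
  linarith

/-- **Kinetic rows bound the double occupancy** (`U > 0`, `d = (e₀ − k)/U`): the energy row and
`KineticRow U klo khi` give `DoccRow U dlo dhi` whenever `U·dlo ≤ elo − khi` and `ehi − klo ≤ U·dhi`.
[cite: WangEtAl2024, §III] [cite: LiebWu1968, eq. (15) and Fig. 3 (d⟨H⟩/dU = Σ⟨n↑n↓⟩, Hellmann–Feynman)] -/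
theorem DoccRow.of_energy_kinetic {U : ℝ} (hU : 0 < U) {elo ehi klo khi dlo dhi : ℚ}
    (hel : M2EnergyLowerRow U elo) (heu : M2EnergyUpperRow U ehi) (hk : KineticRow U klo khi)
    (hdlo : U * dlo ≤ (elo : ℝ) - khi) (hdhi : ((ehi : ℚ) : ℝ) - klo ≤ U * dhi) :
    DoccRow U dlo dhi := by
  intro ω hω
  obtain ⟨hkl, hku⟩ := hk ω hω
  have hel' : ((elo : ℚ) : ℝ) ≤ energyDensity2D 1 U 1 := hel
  have heu' : energyDensity2D 1 U 1 ≤ ((ehi : ℚ) : ℝ) := heu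
  rw [hω.kinetic_eq hU.le] at hkl hku
  constructor
  · by_contra hlt
    rw [not_le] at hlt
    nlinarith [mul_lt_mul_of_pos_left hlt hU]
  · by_contra hlt
    rw [not_le] at hlt
    nlinarith [mul_lt_mul_of_pos_left hlt hU]

end M2

end Summit.Ventures.CertifiedManyBodySolver

end
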